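import Mathlib

set_option linter.dupNamespace false

/-!
# Selmer saturation at the first cyclotomic layer ⇒ residual non-vanishing of Kato's class (sketch)

Crux idea `first-layer-selmer-saturation` on `EllipticUnitValueSevenOfGZK`
(stmt-BirchSwinnertonDyer-19945), research statement K2 `ResidualNonvanishingSeven`
(`z₀ ∉ 7·𝐇¹`) of card `Ideas/abelian-residue-mu-seven.md`.  Planner bsd-idea-20 g56.
No summit statement is proved here; the line of record `Lines/kato_perrin_riou_zp.lean` v9
(sha16 7f643694dfb0cab1) is untouched and nothing is re-registered (W-79).

The mechanism, stripped to algebra (dictionary in the card, §Mechanism):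

* `K`  = global classes `H¹(G_{ℚ₁,S}, E_D[7])` over the first layer `ℚ₁` of the cyclotomic
  `ℤ₇`-extension, `L` = local classes `H¹(ℚ_{7,1}, E_D[7])`, `loc` = localisation at the unique
  prime above `7`, `b` = local Tate pairing (Weil pairing, values in `𝔽₇`),
  `S` = `Sel₇(E_D/ℚ₁)`, `F` = Kummer image `E_D(ℚ_{7,1})/7 ⊂ L`.
* `hrec` is Poitou–Tate reciprocity `∑_v ⟨loc_v k, loc_v s⟩_v = 0` for a global `k` and a SELMER
  `s`, in which every term `v ≠ 7` vanishes (`H¹_f(ℚ_{1,λ}, E_D[7]) = 0` for `λ ∣ D`, unramified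
  classes are orthogonal elsewhere).
* `hsat` is the new crux `SelmerSaturationSeven(D)`: `loc₇ : Sel₇(E_D/ℚ₁) ↠ E_D(ℚ_{7,1})/7`.
* Conclusion of `orthogonal_of_saturation`: every global class is orthogonal at `7` to every
  Kummer class, i.e. its singular part is divisible by `7`; applied to the moment functionals
  `φ_j = b(·, δ Q^{(j)})` of the Gauss-period point `Q = exp_ω(Tr_Δ ζ₄₉ − 6)` of the ADDITIVE
  formal group this says `7 ∣ φ_j(x)` for all global `x` (hypothesis `h7` below, after lifting
  to `ℤ`-valued functionals on `H¹(G_{ℚ₁,S}, T₇E_D)`).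
* `not_exists_eq_smul_of_not_sq_dvd`: with `φ = φ_j ∘ (layer-1 projection)` on `𝐇¹`, the exact
  pairing identity `P₂(z₂) = u·θ⁽⁰⁾₄₉(f_D)` (crux `ExactPairingTwo`) and the certified digits
  `μ(θ) = 1`, `7² ∤ b_j(u θ)` for `j = λ(θ/7)` (crux `DigitTwo`; numerics g56: `λ = 2` for
  `D ∈ {−11,−23,−43,−67,−71}`, `4` for `−79,−107`) give `¬ 49 ∣ φ(z₀)`, hence `z₀ ∉ 7·𝐇¹` = K2.
-/

namespace Summit.BirchSwinnertonDyer.BirchSwinnertonDyer.Cruxes.EllipticUnitValueSevenOfGZK.SelmerSaturation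

section reciprocity

variable {R : Type*} [CommRing R]
variable {K L : Type*} [AddCommGroup K] [Module R K] [AddCommGroup L] [Module R L]

/-- Reciprocity + saturation ⇒ orthogonality: if global classes pair to zero with SELMER classes
under the local pairing at `7` (Poitou–Tate with all other local terms vanishing), and the Selmer
group saturates the local finite part `F`, then every global class is orthogonal to all of `F`
(its singular part is divisible by `p`). -/
theorem orthogonal_of_saturation (loc : K →ₗ[R] L) (b : L →ₗ[R] L →ₗ[R] R)
    (S : Submodule R K) (F : Submodule R L)
    (hrec : ∀ k : K, ∀ s ∈ S, b (loc k) (loc s) = 0)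
    (hsat : F ≤ S.map loc) :
    ∀ k : K, ∀ f ∈ F, b (loc k) f = 0 := by
  intro k f hf
  obtain ⟨s, hs, rfl⟩ := Submodule.mem_map.mp (hsat hf)
  exact hrec k s hs

/-- The same with saturation only of a sub-piece `F' ≤ F` (the `λ`-truncated variant
`DeepSelmerTwo`: only the deepest filtration steps `E'_{7-λ}(ℚ_{7,1})/E'_7` need to be
Selmer-local). -/
theorem orthogonal_of_partial_saturation (loc : K →ₗ[R] L) (b : L →ₗ[R] L →ₗ[R] R)
    (S : Submodule R K) (F' : Submodule R L)
    (hrec : ∀ k : K, ∀ s ∈ S, b (loc k) (loc s) = 0)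
    (hsat : F' ≤ S.map loc) (k : K) {f : L} (hf : f ∈ F') :
    b (loc k) f = 0 :=
  orthogonal_of_saturation loc b S F' hrec hsat k f hf

end reciprocity

section digit

/-- Digit step: if an additive functional `φ` (a moment of the Kurihara pairing) is divisible by
`p` on the whole module of global classes, then an element `z` with `p² ∤ φ z` is not `p` times a
global class.  With `p = 7`, `φ = b_λ ∘ P₂ ∘ pr₁` and `z = z₀` this is K2 from
`SelmerSaturationSeven ∧ ExactPairingTwo ∧ DigitTwo`. -/
theorem not_exists_eq_smul_of_not_sq_dvd {H : Type*} [AddCommGroup H]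
    (φ : H →+ ℤ) (p : ℤ) (h : ∀ x : H, p ∣ φ x) (z : H) (hz : ¬ p ^ 2 ∣ φ z) :
    ¬ ∃ w : H, z = p • w := by
  rintro ⟨w, rfl⟩
  apply hz
  obtain ⟨c, hc⟩ := h w
  exact ⟨c, by rw [map_zsmul, smul_eq_mul, hc]; ring⟩

/-- Range form of the digit step: `z ∉ p • H`. -/
theorem not_mem_range_smul_of_not_sq_dvd {H : Type*} [AddCommGroup H]
    (φ : H →+ ℤ) (p : ℤ) (h : ∀ x : H, p ∣ φ x) (z : H) (hz : ¬ p ^ 2 ∣ φ z) :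
    z ∉ Set.range (fun w : H => p • w) := by
  rintro ⟨w, hw⟩
  exact not_exists_eq_smul_of_not_sq_dvd φ p h z hz ⟨w, hw.symm⟩

/-- The group-ring digit fact used for `hz`: in `ℤ[Γ]`-free language — if `θ = p • ϑ` and the
`j`-th coefficient functional `c` satisfies `p ∤ c ϑ`, then `p² ∤ c θ`. -/
theorem not_sq_dvd_of_digit {M : Type*} [AddCommGroup M] (c : M →+ ℤ) (p : ℤ) (hp : p ≠ 0)
    (θ ϑ : M) (hθ : θ = p • ϑ) (hunit : ¬ p ∣ c ϑ) : ¬ p ^ 2 ∣ c θ := by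
  rintro ⟨d, hd⟩
  apply hunit
  refine ⟨d, ?_⟩
  have : p * c ϑ = p * (p * d) := by
    rw [hθ, map_zsmul, smul_eq_mul] at hd
    rw [hd]; ring
  exact mul_left_cancel₀ hp this

/-- First-digit step (the NAIVE lever, REV 2: it fires on the a1-side of `𝒞₇`, where Kato's
period is the optimal Néron period and `μ(θ⁺₄₉(f_D)) = 0`): if some additive functional `φ`
(a coefficient of the Kurihara pairing `P₂`, valued in `ℤ`) is NOT divisible by `p` at `z`,
then `z` is not `p` times a class.  No Selmer input at all. -/
theorem not_exists_eq_smul_of_not_dvd {H : Type*} [AddCommGroup H]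
    (φ : H →+ ℤ) (p : ℤ) (z : H) (hz : ¬ p ∣ φ z) : ¬ ∃ w : H, z = p • w := by
  rintro ⟨w, rfl⟩
  exact hz ⟨φ w, by rw [map_zsmul, smul_eq_mul]⟩

/-- Transfer of the first-digit step along a homomorphism (Iwasawa module `𝐇¹ → H¹` at layer 1):
if `pr z₀` is not `p`-divisible downstairs, `z₀` is not `p`-divisible upstairs. -/
theorem not_exists_eq_smul_of_map {A B : Type*} [AddCommGroup A] [AddCommGroup B]
    (pr : A →+ B) (p : ℤ) (z₀ : A) (h : ¬ ∃ w : B, pr z₀ = p • w) :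
    ¬ ∃ w : A, z₀ = p • w := by
  rintro ⟨w, rfl⟩
  exact h ⟨pr w, by rw [map_zsmul]⟩

/-- The a1-side chain of card REV 2, composed: `P₂` = Kurihara pairing at layer 1 (a group
homomorphism to the group ring, here any abelian group `G`), `c` = a `ℤ`-valued coefficient
functional, `pr` = the projection `𝐇¹ → H¹(layer 1)`.  If the coefficient `c (P₂ (pr z₀))` is
not divisible by `p` (ExactPairingTwo + Kato's period optimal + unit first digit), then
`z₀ ∉ p·𝐇¹` — K2 at that `D`. -/
theorem k2_of_unit_coefficient {IwH1 H1 G : Type*} [AddCommGroup IwH1] [AddCommGroup H1]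
    [AddCommGroup G] (pr : IwH1 →+ H1) (P₂ : H1 →+ G) (c : G →+ ℤ) (p : ℤ) (z₀ : IwH1)
    (hunit : ¬ p ∣ c (P₂ (pr z₀))) : ¬ ∃ w : IwH1, z₀ = p • w :=
  not_exists_eq_smul_of_map pr p z₀
    (not_exists_eq_smul_of_not_dvd (c.comp P₂) p (pr z₀) (by simpa using hunit))

end digit

end Summit.BirchSwinnertonDyer.BirchSwinnertonDyer.Cruxes.EllipticUnitValueSevenOfGZK.SelmerSaturation
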